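import Summits.QuantumFields.YangMills.Theorems.ContractibleFibreFibreToTorusStubTubeMixingState
import Mathlib.MeasureTheory.Measure.Decomposition.RadonNikodym
import HarnessLib

/-!
# Helper `mixing_isExtremal` of line `Sketch`, crux `FibreToTorus` (stmt-QuantumFields-16244)

First lemma `MixingIsExtremal` of idea card `ergodic-selection`: a probability measure `μ` on the
`ℤ⁴`-gauge configurations `LGConfig 4 G` which is MIXING under the time shift `configShift (-n e₀)` on all
pairs of bounded measurable functions is an extreme point of the time-invariant probability measures — it
is not a non-trivial convex combination `t ν₁ + (1 - t) ν₂`, `0 < t < 1`, of two distinct time-invariant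
probability measures (Walters, *An Introduction to Ergodic Theory*, Thm. 1.6 shape; Georgii 2011,
Thm. 14.15 shape).

Proof, avoiding ergodic σ-algebras (`eq_of_smul_le_of_timeMixing`): if `c • ν ≤ μ` with `0 < c < ∞` and
`ν` is a time-invariant probability measure, the density `f = d(c ν)/dμ ≤ 1` (`μ`-a.e.) yields the test
function `F = min 1 f.toReal`, measurable with values in `[0, 1]`, for which
`∫ F · (H ∘ s_n) dμ = c ∫ H ∘ s_n dν = c ∫ H dν` and `∫ F dμ = c`; as `μ` is time invariant too, the mixing
sequence of the pair `(F, H)` is the constant `c (∫ H dν - ∫ H dμ)`, so `∫ H dν = ∫ H dμ` for every bounded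
measurable `H`, and `ν = μ` (indicators).  Applied to `ν₁` (`c = t`) and `ν₂` (`c = 1 - t`) this gives
`ν₁ = μ = ν₂`.
-/

noncomputable section

open MeasureTheory Filter Topology
open scoped ENNReal
open Literature.MathematicalPhysics.QuantumLattice (LGConfig ZdEdge configShift configShift_apply)

namespace Summit.QuantumFields.YangMills.Theorems.FibreToTorus

variable {G : Type} [MeasurableSpace G]

/-- **A time-invariant probability measure a positive multiple of which is dominated by a time-mixing,
time-invariant probability measure is equal to it.**  If `μ` is mixing under the time shifts
`configShift (-n e₀)` on pairs of bounded measurable functions and invariant under them, `ν` is a probability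
measure invariant under the same shifts, and `c • ν ≤ μ` for some `0 < c < ∞`, then `ν = μ`
(Walters Thm. 1.6, density form: the bounded invariant density `d(cν)/dμ` is tested against the mixing
property). [folklore] -/
theorem eq_of_smul_le_of_timeMixing (μ ν : Measure (LGConfig 4 G)) [IsProbabilityMeasure μ]
    [IsProbabilityMeasure ν]
    (hmix : ∀ F H : LGConfig 4 G → ℝ, Measurable F → Measurable H → (∀ U, |F U| ≤ 1) →
      (∀ U, |H U| ≤ 1) → Tendsto (fun n : ℕ =>
        (∫ U, F U * H (configShift (-Pi.single 0 (n : ℤ)) U) ∂μ) -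
          (∫ U, F U ∂μ) * ∫ U, H (configShift (-Pi.single 0 (n : ℤ)) U) ∂μ) atTop (𝓝 0))
    (hμ : ∀ n : ℕ, μ.map (configShift (-Pi.single 0 (n : ℤ))) = μ)
    (hν : ∀ n : ℕ, ν.map (configShift (-Pi.single 0 (n : ℤ))) = ν)
    {c : ℝ≥0∞} (hc0 : c ≠ 0) (hctop : c ≠ ∞) (hle : c • ν ≤ μ) : ν = μ := by
  -- the density of `c • ν` with respect to `μ` is at most `1`
  haveI : IsFiniteMeasure (c • ν) := isFiniteMeasure_of_le μ hle
  have hac : c • ν ≪ μ := Measure.absolutelyContinuous_of_le hle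
  set f : LGConfig 4 G → ℝ≥0∞ := (c • ν).rnDeriv μ with hf_def
  have hf1 : f ≤ᵐ[μ] 1 := Measure.rnDeriv_le_one_of_le hle
  have hfm : Measurable f := Measure.measurable_rnDeriv _ _
  -- the test function `F = min 1 f`
  set F : LGConfig 4 G → ℝ := fun U => min 1 (f U).toReal with hF_def
  have hFm : Measurable F := measurable_const.min hfm.ennreal_toReal
  have hFb : ∀ U, |F U| ≤ 1 := fun U =>
    abs_le.2 ⟨le_min (by norm_num) (by linarith [ENNReal.toReal_nonneg (a := f U)]), min_le_left _ _⟩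
  have hFae : F =ᵐ[μ] fun U => (f U).toReal := by
    filter_upwards [hf1] with U hU
    have h1 : (f U).toReal ≤ 1 := by
      have h := ENNReal.toReal_mono ENNReal.one_ne_top hU
      simpa using h
    exact min_eq_right h1
  -- `∫ F g dμ = c ∫ g dν`
  have key : ∀ g : LGConfig 4 G → ℝ, ∫ U, F U * g U ∂μ = c.toReal * ∫ U, g U ∂ν := by
    intro g
    calc ∫ U, F U * g U ∂μ = ∫ U, (f U).toReal • g U ∂μ :=
          integral_congr_ae (hFae.mono fun U hU => by
            show F U * g U = (f U).toReal • g U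
            rw [hU, smul_eq_mul])
      _ = ∫ U, g U ∂(c • ν) := integral_rnDeriv_smul hac
      _ = c.toReal * ∫ U, g U ∂ν := by rw [integral_smul_measure, smul_eq_mul]
  have hF1 : ∫ U, F U ∂μ = c.toReal := by
    have h := key (fun _ => 1)
    simpa only [mul_one, integral_const, probReal_univ, one_smul] using h
  -- for bounded measurable `H`, `∫ H dν = ∫ H dμ`
  have hint : ∀ H : LGConfig 4 G → ℝ, Measurable H → (∀ U, |H U| ≤ 1) →
      ∫ U, H U ∂ν = ∫ U, H U ∂μ := by
    intro H hHm hHb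
    have hconst : ∀ n : ℕ,
        (∫ U, F U * H (configShift (-Pi.single 0 (n : ℤ)) U) ∂μ) -
          (∫ U, F U ∂μ) * ∫ U, H (configShift (-Pi.single 0 (n : ℤ)) U) ∂μ =
        c.toReal * ((∫ U, H U ∂ν) - ∫ U, H U ∂μ) := by
      intro n
      have h1 : ∫ U, H (configShift (-Pi.single 0 (n : ℤ)) U) ∂ν = ∫ U, H U ∂ν := by
        rw [← integral_map_equiv (configShift (-Pi.single 0 (n : ℤ))) H, hν n]
      have h2 : ∫ U, H (configShift (-Pi.single 0 (n : ℤ)) U) ∂μ = ∫ U, H U ∂μ := by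
        rw [← integral_map_equiv (configShift (-Pi.single 0 (n : ℤ))) H, hμ n]
      rw [key, h1, hF1, h2, mul_sub]
    have ht : Tendsto (fun _ : ℕ => c.toReal * ((∫ U, H U ∂ν) - ∫ U, H U ∂μ)) atTop (𝓝 0) :=
      (hmix F H hFm hHm hFb hHb).congr hconst
    have h0 := tendsto_const_nhds_iff.1 ht
    have hc' : c.toReal ≠ 0 := ENNReal.toReal_ne_zero.2 ⟨hc0, hctop⟩
    have h00 := (mul_eq_zero.1 h0).resolve_left hc'
    linarith
  -- conclude by testing indicators of measurable sets
  ext S hS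
  have h := hint (S.indicator 1) (measurable_one.indicator hS) (fun U => by
    by_cases hU : U ∈ S <;> simp [hU])
  rw [integral_indicator_one hS, integral_indicator_one hS] at h
  exact (measureReal_eq_measureReal_iff (measure_ne_top _ _) (measure_ne_top _ _)).1 h

/-- **`MixingIsExtremal` (card `ergodic-selection`, first lemma; registered helper of line `Sketch`).**
A probability measure on `LGConfig 4 G` which is mixing under the time shift on all pairs of bounded
measurable functions is not a non-trivial convex combination of two distinct time-invariant probability
measures: `μ = t ν₁ + (1 - t) ν₂` with `0 < t < 1` and `ν₁, ν₂` invariant under the unit time translation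
forces `ν₁ = ν₂` (Walters Thm. 1.6 / Georgii 2011 Thm. 14.15 shape).  Proof: `μ` is time invariant
(push the decomposition through the shift), `t ν₁ ≤ μ` and `(1 - t) ν₂ ≤ μ`, so
`eq_of_smul_le_of_timeMixing` gives `ν₁ = μ = ν₂`. -/
theorem mixing_isExtremal : ∀ (G : Type) [MeasurableSpace G] (μ ν₁ ν₂ : MeasureTheory.Measure (LGConfig 4 G)), MeasureTheory.IsProbabilityMeasure μ → MeasureTheory.IsProbabilityMeasure ν₁ → MeasureTheory.IsProbabilityMeasure ν₂ → (∀ F H : LGConfig 4 G → ℝ, Measurable F → Measurable H → (∀ U, |F U| ≤ 1) → (∀ U, |H U| ≤ 1) → Filter.Tendsto (fun n : ℕ => (∫ U, F U * H (configShift (-Pi.single 0 (n : ℤ)) U) ∂μ) - (∫ U, F U ∂μ) * ∫ U, H (configShift (-Pi.single 0 (n : ℤ)) U) ∂μ) Filter.atTop (nhds 0)) → ν₁.map (configShift (Pi.single 0 1)) = ν₁ → ν₂.map (configShift (Pi.single 0 1)) = ν₂ → ∀ t : ℝ, 0 < t → t < 1 → μ = ENNReal.ofReal t • ν₁ + ENNReal.ofReal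 (1 - t) • ν₂ → ν₁ = ν₂ := by
  intro G _ μ ν₁ ν₂ hμP hν₁P hν₂P hmix h₁ h₂ t ht0 ht1 hμ
  -- `μ` is invariant under the unit time translation
  have hμinv : μ.map (configShift (Pi.single 0 1)) = μ := by
    conv_lhs => rw [hμ]
    rw [Measure.map_add _ _ (configShift _).measurable, Measure.map_smul, Measure.map_smul, h₁, h₂]
    exact hμ.symm
  have hμn := map_configShift_neg_nsmul_eq μ hμinv
  have hν₁n := map_configShift_neg_nsmul_eq ν₁ h₁
  have hν₂n := map_configShift_neg_nsmul_eq ν₂ h₂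
  -- both pieces are dominated by `μ`
  have hle₁ : ENNReal.ofReal t • ν₁ ≤ μ := by
    rw [hμ]
    exact Measure.le_add_right le_rfl
  have hle₂ : ENNReal.ofReal (1 - t) • ν₂ ≤ μ := by
    rw [hμ]
    exact Measure.le_add_left le_rfl
  have e₁ : ν₁ = μ := eq_of_smul_le_of_timeMixing μ ν₁ hmix hμn hν₁n
    (ENNReal.ofReal_pos.2 ht0).ne' ENNReal.ofReal_ne_top hle₁
  have e₂ : ν₂ = μ := eq_of_smul_le_of_timeMixing μ ν₂ hmix hμn hν₂n
    (ENNReal.ofReal_pos.2 (by linarith)).ne' ENNReal.ofReal_ne_top hle₂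
  rw [e₁, e₂]

end Summit.QuantumFields.YangMills.Theorems.FibreToTorus

end
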